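/-
Copyright: statement-level skeleton of a published paper (lit-balaban cell, Phase-2 proof seat p39 gen 4). No proof claims
beyond what the kernel checks below.
-/
import Mathlib.Analysis.Real.Pi.Bounds
import Literature.MathematicalPhysics.QuantumFieldTheory.Balaban1983to89.B3CxiBesselKernel

/-!
# B3 — T. Bałaban, *(Higgs)₂,₃ quantum fields in a finite volume. III. Renormalization*, CMP **88** (1983) 411–445
[Balaban1983Higgs3], p. 437: towards the printed clause *"and the corresponding inequalities for derivatives"* for the free
propagator C^ξ = (−Δ^ξ+1)^{−1} on ξℤ³ — FILE 1/2: the tilted Poisson bound for the DISCRETE DERIVATIVE of the one-dimensional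
Poissonized kernel F(s,n) = I_n(2s)

statement-level skeleton of published theorems with citation tags; proofs where landed; nothing here is a claim about
the Yang–Mills mass gap

PDF held: `paper:balaban1983-higgs-2-3-quantum-fields-finite-volume` (journal page = PDF page + 410), p. 437 [PDF 27].
WHAT IS REPRODUCED: kernel infrastructure for row **B3.Eq3.11-3.17** of `HOME/lit-balaban-r15/ROWS-B3.md` (reader/typer r15,
fold owner of B3) — the p. 437 sentence *"Using the inequalities |C^ξ(y − y′)| ≦ O(1)e^{−½|y−y′|}/|y − y′|,
|G^ξ_{j″}(0; y, y′)| ≦ O(1)e^{−δ₀|y−y′|}/|y − y′|, and the corresponding inequalities for derivatives, we can estimate (3.16) by a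
constant"* — here the input for the DERIVATIVE bound of the free propagator (file 2: `B3CxiDerivativeBound`,
|∂^ξ_νC^ξ(y)| ≤ O(1)e^{−½ξ|y|}/(ξ|y|)² on ξℤ³ uniformly in 0 < ξ ≤ 1).  Unit `lit-balaban-p39-g4` (Phase-2 proof seat p39, gen 4),
HOME `run/shared/lean/pub/lit-balaban/`.  The paper prints no proof (it refers to its general propagator estimates); the proof
here continues the heat-kernel (Poissonization) proof of the undifferentiated bound (`B3CxiBesselKernel` → `B3CxiPoissonization`
→ `B3CxiUniformBound`, this seat gen 3): the lattice derivative ∂_ν acts on ONE factor of the separated kernel Π_μF(θt,|y_μ|), as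
the discrete derivative n ↦ F(s,n+1) − F(s,n) of the one-dimensional kernel F(s,n) = Σ_j s^j/j!·s^{j+n}/(j+n)! (= I_n(2s)), and the
whole content of this file is the bound
**|F(s,n) − F(s,n+1)| ≤ (2/√(1+s))·e^{2s cosh a − a·n}·(5/(4√(1+s)) + a)** for all s ≥ 0, a ≥ 0, n ∈ ℕ (`abs_besselF_sub_succ_le`)
— the tilted Poisson bound `B3CxiBesselKernel.besselF_le` F(s,n) ≤ (2/√(1+s))e^{2s cosh a − an} GAINS A FACTOR (1+s)^{−1/2} (up to
the tilt a) under differencing.  Mechanism (kernel-checked): after tilting (`B3CxiBesselKernel.besselTerm_mul_exp`),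
(F(s,n) − F(s,n+1))e^{an} = e^{λ₁+λ₂}Σ_j Poi_{λ₁}(j)[Poi_{λ₂}(j+n) − e^{−a}Poi_{λ₂}(j+n+1)], λ₁ = se^{−a}, λ₂ = se^{a} ≥ s, and the
DIFFERENCES of the Poisson probability mass function are uniformly small: **|Poi_λ(m+1) − Poi_λ(m)| ≤ (5/2)/(1+λ)**
(`abs_poissonPMF_succ_sub_le`), because Poi_λ(m+1) − Poi_λ(m) = Poi_λ(m+1)(λ − (m+1))/λ and **|k − λ|·Poi_λ(k) ≤ 6/5** for k ≥ 1
(`abs_sub_mul_poissonPMF_le`: Stirling's lower bound k! ≥ √(2πk)(k/e)^k and the Gaussian shape of the Poisson weights,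
exp(k − λ + k log(λ/k)) ≤ e^{−(k−λ)²/(k+λ)} for k ≥ λ [Mathlib `Real.le_log_one_add_of_nonneg`: log(1+x) ≥ 2x/(x+2)] and
≤ e^{−(λ−k)²/(2λ)} for k ≤ λ [Mathlib `Real.self_le_sinh_iff`: log v ≤ sinh(log v) = (v − v⁻¹)/2]).  Mathlib + `B3CxiBesselKernel`
only; no new definitions; no named facts.
-/

open scoped BigOperators
open Real

namespace Literature.MathematicalPhysics.QuantumFieldTheory.Balaban1983to89.B3CxiBesselDifference

open B3CxiBesselKernel

noncomputable section

/-! ## 1. Elementary inequalities -/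

/-- kernel: e·x ≤ e^x for every real x (tangent line at x = 1). [folklore] -/
private theorem exp_one_mul_le_exp (x : ℝ) : Real.exp 1 * x ≤ Real.exp x := by
  have h := Real.add_one_le_exp (x - 1)
  have h2 : Real.exp (x - 1) = Real.exp x / Real.exp 1 := by rw [Real.exp_sub]
  rw [h2, le_div_iff₀ (Real.exp_pos 1)] at h
  linarith

/-- kernel: D·e^{−D²/S} ≤ √S/2 for S > 0 (e^{t²} ≥ 1 + t² ≥ 2t with t = D/√S). [folklore] -/
private theorem mul_exp_neg_sq_div_le {D S : ℝ} (hS : 0 < S) : D * Real.exp (-(D ^ 2 / S)) ≤ Real.sqrt S / 2 := by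
  have hsq : 0 < Real.sqrt S := Real.sqrt_pos.mpr hS
  have hS2 : Real.sqrt S ^ 2 = S := Real.sq_sqrt hS.le
  set t := D / Real.sqrt S with ht
  have hD : D = t * Real.sqrt S := by rw [ht]; field_simp
  have hDS : D ^ 2 / S = t ^ 2 := by rw [hD, mul_pow, hS2]; field_simp
  rw [hDS, hD]
  have h1 : 2 * t ≤ Real.exp (t ^ 2) := by nlinarith [Real.add_one_le_exp (t ^ 2), sq_nonneg (t - 1)]
  have h2 : t * Real.exp (-(t ^ 2)) ≤ 1 / 2 := by
    rw [Real.exp_neg, ← div_eq_mul_inv, div_le_iff₀ (Real.exp_pos _)]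
    linarith
  calc t * Real.sqrt S * Real.exp (-t ^ 2) = Real.sqrt S * (t * Real.exp (-(t ^ 2))) := by ring
    _ ≤ Real.sqrt S * (1 / 2) := mul_le_mul_of_nonneg_left h2 hsq.le
    _ = Real.sqrt S / 2 := by ring

/-- kernel: √(2π) ≥ 5/2. [folklore] -/
private theorem sqrt_two_pi_ge : (5 / 2 : ℝ) ≤ Real.sqrt (2 * Real.pi) := by
  rw [show (5 / 2 : ℝ) = Real.sqrt ((5 / 2) ^ 2) by rw [Real.sqrt_sq (by norm_num)]]
  exact Real.sqrt_le_sqrt (by nlinarith [Real.pi_gt_d2])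

/-- kernel (Gaussian shape of the Poisson exponent above the mean): for 0 < λ ≤ k,
k − λ + k·log(λ/k) ≤ −(k−λ)²/(k+λ), from log(k/λ) ≥ 2(k−λ)/(k+λ) (Mathlib `Real.le_log_one_add_of_nonneg`). [folklore] -/
private theorem exponent_le_above {lam k : ℝ} (hlam : 0 < lam) (hk : lam ≤ k) :
    k - lam + k * Real.log (lam / k) ≤ -((k - lam) ^ 2 / (k + lam)) := by
  have hkpos : 0 < k := lt_of_lt_of_le hlam hk
  set x := (k - lam) / lam with hx
  have hx0 : 0 ≤ x := div_nonneg (by linarith) hlam.le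
  have h1x : 1 + x = k / lam := by rw [hx]; field_simp; ring
  have hlog := Real.le_log_one_add_of_nonneg hx0
  rw [h1x] at hlog
  have hkl : Real.log (lam / k) = -Real.log (k / lam) := by
    rw [← Real.log_inv, inv_div]
  have hkl' : k + lam ≠ 0 := by linarith
  have hx2 : x + 2 = (k + lam) / lam := by rw [hx]; field_simp; ring
  have h2x : 2 * x / (x + 2) = 2 * (k - lam) / (k + lam) := by
    rw [hx2, hx, ← mul_div_assoc, div_div_div_cancel_right₀ hlam.ne']
  rw [h2x] at hlog
  rw [hkl]
  have hS : 0 < k + lam := by linarith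
  -- k·log(k/λ) ≥ 2k(k−λ)/(k+λ)
  have h3 : k * (2 * (k - lam) / (k + lam)) ≤ k * Real.log (k / lam) := mul_le_mul_of_nonneg_left hlog hkpos.le
  have e : k - lam - k * (2 * (k - lam) / (k + lam)) = -((k - lam) ^ 2 / (k + lam)) := by
    field_simp; ring
  linarith

/-- kernel (Gaussian shape of the Poisson exponent below the mean): for 0 < k ≤ λ,
k − λ + k·log(λ/k) ≤ −(λ−k)²/(2λ), from log v ≤ sinh(log v) = (v − v⁻¹)/2 for v = λ/k ≥ 1 (Mathlib `Real.self_le_sinh_iff`).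
[folklore] -/
private theorem exponent_le_below {lam k : ℝ} (hk : 0 < k) (hkl : k ≤ lam) :
    k - lam + k * Real.log (lam / k) ≤ -((lam - k) ^ 2 / (2 * lam)) := by
  have hlam : 0 < lam := lt_of_lt_of_le hk hkl
  have hv : 0 < lam / k := div_pos hlam hk
  have hlog0 : 0 ≤ Real.log (lam / k) := Real.log_nonneg ((one_le_div hk).mpr hkl)
  have hsinh : Real.log (lam / k) ≤ Real.sinh (Real.log (lam / k)) := Real.self_le_sinh_iff.mpr hlog0
  rw [Real.sinh_eq, Real.exp_log hv, Real.exp_neg, Real.exp_log hv, inv_div] at hsinh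
  -- k·log(λ/k) ≤ k(λ/k − k/λ)/2 = (λ − k²/λ)/2
  have h3 : k * Real.log (lam / k) ≤ k * ((lam / k - k / lam) / 2) := mul_le_mul_of_nonneg_left hsinh hk.le
  have e : k - lam + k * ((lam / k - k / lam) / 2) = -((lam - k) ^ 2 / (2 * lam)) := by
    field_simp; ring
  linarith

/-! ## 2. The Poisson probability mass function: differences are ≤ (5/2)/(1+λ) -/

variable {lam : ℝ}

/-- kernel: Poi_λ(m) ≤ 1. [cite: Balaban1983Higgs3, (3.16) p.437] -/
theorem poissonPMF_le_one (hlam : 0 ≤ lam) (m : ℕ) : poissonPMF lam m ≤ 1 :=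
  le_hasSum (hasSum_poissonPMF hlam) m fun j _ => poissonPMF_nonneg hlam j

/-- kernel (the size-biasing identity): (m+1)·Poi_λ(m+1) = λ·Poi_λ(m). [cite: Balaban1983Higgs3, (3.16) p.437] -/
theorem succ_mul_poissonPMF_succ (lam : ℝ) (m : ℕ) :
    ((m : ℝ) + 1) * poissonPMF lam (m + 1) = lam * poissonPMF lam m := by
  unfold poissonPMF
  rw [Nat.factorial_succ, Nat.cast_mul, pow_succ]
  push_cast
  have hm : ((m : ℝ) + 1) ≠ 0 := by positivity
  have hf : ((m.factorial : ℕ) : ℝ) ≠ 0 := by positivity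
  field_simp

/-- kernel (Stirling): for λ > 0 and k ≥ 1, Poi_λ(k) ≤ exp(k − λ + k·log(λ/k))/√(2πk) (k! ≥ √(2πk)(k/e)^k,
Mathlib `Stirling.le_factorial_stirling`). [cite: Balaban1983Higgs3, (3.16) p.437] -/
theorem poissonPMF_le_exp_div_sqrt (hlam : 0 < lam) {k : ℕ} (hk : k ≠ 0) :
    poissonPMF lam k ≤ Real.exp (k - lam + k * Real.log (lam / k)) / Real.sqrt (2 * Real.pi * k) := by
  have hst := Stirling.le_factorial_stirling k
  have hkpos : (0 : ℝ) < k := by exact_mod_cast Nat.pos_of_ne_zero hk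
  have hsq : 0 < Real.sqrt (2 * Real.pi * k) := Real.sqrt_pos.2 (by positivity)
  have hden : 0 < Real.sqrt (2 * Real.pi * k) * (k / Real.exp 1) ^ k := by positivity
  have hlk : 0 < lam / k := div_pos hlam hkpos
  -- (eλ/k)^k · e^{−λ} = exp(k − λ + k log(λ/k))
  have hexp : Real.exp (-lam) * lam ^ k / (k / Real.exp 1) ^ k = Real.exp (k - lam + k * Real.log (lam / k)) := by
    have e1 : lam ^ k / (k / Real.exp 1) ^ k = (Real.exp 1 * (lam / k)) ^ k := by
      rw [← div_pow]; congr 1; field_simp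
    have e2 : (Real.exp 1 * (lam / k)) ^ k = Real.exp (k + k * Real.log (lam / k)) := by
      rw [show Real.exp 1 * (lam / k) = Real.exp (1 + Real.log (lam / k)) by
        rw [Real.exp_add, Real.exp_log hlk], ← Real.exp_nat_mul]
      congr 1; ring
    rw [mul_div_assoc, e1, e2, ← Real.exp_add]
    congr 1; ring
  unfold poissonPMF
  calc Real.exp (-lam) * lam ^ k / k.factorial
      ≤ Real.exp (-lam) * lam ^ k / (Real.sqrt (2 * Real.pi * k) * (k / Real.exp 1) ^ k) :=
        div_le_div_of_nonneg_left (by positivity) hden hst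
    _ = Real.exp (-lam) * lam ^ k / (k / Real.exp 1) ^ k / Real.sqrt (2 * Real.pi * k) := by
        rw [div_div, mul_comm (((k : ℝ) / Real.exp 1) ^ k)]
    _ = _ := by rw [hexp]

/-- **|k − λ|·Poi_λ(k) ≤ 6/5 for λ > 0 and k ≥ 1** (the Poisson weights times the deviation from the mean are uniformly bounded:
Stirling and the Gaussian shape exp(k − λ + k log(λ/k)) ≤ e^{−(k−λ)²/(k+λ)} (k ≥ λ), ≤ e^{−(λ−k)²/(2λ)} (k ≤ λ), ≤ e^{−λ/8}
(2k ≤ λ), with D·e^{−D²/S} ≤ √S/2 and e·x ≤ e^x). [cite: Balaban1983Higgs3, (3.16) p.437] -/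
theorem abs_sub_mul_poissonPMF_le (hlam : 0 < lam) {k : ℕ} (hk : k ≠ 0) :
    |(k : ℝ) - lam| * poissonPMF lam k ≤ 6 / 5 := by
  have hkpos : (0 : ℝ) < k := by exact_mod_cast Nat.pos_of_ne_zero hk
  have hk1 : (1 : ℝ) ≤ k := by exact_mod_cast Nat.one_le_iff_ne_zero.mpr hk
  have hP := poissonPMF_le_exp_div_sqrt hlam hk
  have hsq : 0 < Real.sqrt (2 * Real.pi * k) := Real.sqrt_pos.2 (by positivity)
  have hsq52 : 5 / 2 ≤ Real.sqrt (2 * Real.pi * k) := by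
    refine sqrt_two_pi_ge.trans (Real.sqrt_le_sqrt ?_)
    nlinarith [Real.pi_pos]
  have habs : 0 ≤ |(k : ℝ) - lam| := abs_nonneg _
  -- generic step: |k−λ|·Poi ≤ |k−λ|·e^{E}/√(2πk)
  have hstep : |(k : ℝ) - lam| * poissonPMF lam k ≤
      |(k : ℝ) - lam| * Real.exp (k - lam + k * Real.log (lam / k)) / Real.sqrt (2 * Real.pi * k) := by
    rw [mul_div_assoc]; exact mul_le_mul_of_nonneg_left hP habs
  refine hstep.trans ?_
  rw [div_le_iff₀ hsq]
  rcases le_or_gt lam k with hcase | hcase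
  · -- k ≥ λ: |k−λ|e^{E} ≤ (k−λ)e^{−(k−λ)²/(k+λ)} ≤ √(k+λ)/2 ≤ √(2k)/2 ≤ (6/5)√(2πk)… via √(2k) ≤ √(2πk)
    rw [abs_of_nonneg (by linarith : (0 : ℝ) ≤ k - lam)]
    have hE := exponent_le_above hlam hcase
    have hS : 0 < (k : ℝ) + lam := by linarith
    have h1 : ((k : ℝ) - lam) * Real.exp (k - lam + k * Real.log (lam / k)) ≤ Real.sqrt (k + lam) / 2 :=
      calc ((k : ℝ) - lam) * Real.exp (k - lam + k * Real.log (lam / k))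
          ≤ ((k : ℝ) - lam) * Real.exp (-(((k : ℝ) - lam) ^ 2 / (k + lam))) :=
            mul_le_mul_of_nonneg_left (Real.exp_le_exp.mpr hE) (by linarith)
        _ ≤ Real.sqrt (k + lam) / 2 := mul_exp_neg_sq_div_le hS
    have h2 : Real.sqrt ((k : ℝ) + lam) ≤ Real.sqrt (2 * Real.pi * k) :=
      Real.sqrt_le_sqrt (by nlinarith [Real.pi_gt_three])
    linarith
  · rw [abs_of_neg (by linarith : (k : ℝ) - lam < 0), neg_sub]
    have hE := exponent_le_below hkpos hcase.le
    rcases le_or_gt lam (2 * k) with h2k | h2k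
    · -- λ/2 ≤ k < λ: (λ−k)e^{E} ≤ (λ−k)e^{−(λ−k)²/(2λ)} ≤ √(2λ)/2 ≤ √(4k)/2 ≤ (6/5)√(2πk)
      have hS : 0 < 2 * lam := by linarith
      have h1 : (lam - k) * Real.exp (k - lam + k * Real.log (lam / k)) ≤ Real.sqrt (2 * lam) / 2 :=
        calc (lam - k) * Real.exp (k - lam + k * Real.log (lam / k))
            ≤ (lam - k) * Real.exp (-((lam - (k : ℝ)) ^ 2 / (2 * lam))) :=
              mul_le_mul_of_nonneg_left (Real.exp_le_exp.mpr hE) (by linarith)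
          _ ≤ Real.sqrt (2 * lam) / 2 := mul_exp_neg_sq_div_le hS
      have h2 : Real.sqrt (2 * lam) ≤ Real.sqrt (2 * Real.pi * k) :=
        Real.sqrt_le_sqrt (by nlinarith [Real.pi_gt_three])
      linarith
    · -- 2k < λ: (λ−k)e^{E} ≤ λe^{−λ/8} ≤ 8/e ≤ 3 ≤ (6/5)·(5/2) ≤ (6/5)√(2πk)
      have hE' : k - lam + k * Real.log (lam / k) ≤ -(lam / 8) := by
        refine hE.trans ?_
        have h4 : lam ^ 2 / 4 ≤ (lam - k) ^ 2 := by nlinarith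
        have h5 : lam / 8 ≤ (lam - k) ^ 2 / (2 * lam) := by
          rw [le_div_iff₀ (by linarith)]; nlinarith
        linarith
      have h1 : (lam - k) * Real.exp (k - lam + k * Real.log (lam / k)) ≤ lam * Real.exp (-(lam / 8)) :=
        mul_le_mul (by linarith) (Real.exp_le_exp.mpr hE') (Real.exp_pos _).le hlam.le
      -- λe^{−λ/8} = 8·(λ/8)·e^{−λ/8} ≤ 8/e
      have h2 : lam * Real.exp (-(lam / 8)) ≤ 8 / Real.exp 1 := by
        have h := exp_one_mul_le_exp (lam / 8)
        rw [Real.exp_neg, le_div_iff₀ (Real.exp_pos 1)]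
        have hpos := Real.exp_pos (lam / 8)
        calc lam * (Real.exp (lam / 8))⁻¹ * Real.exp 1 = 8 * (Real.exp 1 * (lam / 8)) / Real.exp (lam / 8) := by
              field_simp
          _ ≤ 8 * Real.exp (lam / 8) / Real.exp (lam / 8) := by gcongr
          _ = 8 := by field_simp
      have h3 : 8 / Real.exp 1 ≤ 3 := by
        rw [div_le_iff₀ (Real.exp_pos 1)]; linarith [Real.exp_one_gt_d9]
      linarith

/-- **The differences of the Poisson probability mass function are ≤ (5/2)/(1+λ)**, uniformly in the argument:
|Poi_λ(m+1) − Poi_λ(m)| ≤ (5/2)/(1+λ) for λ ≥ 0, m ∈ ℕ — from Poi_λ(m+1) − Poi_λ(m) = Poi_λ(m+1)(λ − (m+1))/λ,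
`abs_sub_mul_poissonPMF_le` (giving (6/5)/λ) and Poi ≤ 1. [cite: Balaban1983Higgs3, (3.16) p.437] -/
theorem abs_poissonPMF_succ_sub_le (hlam : 0 ≤ lam) (m : ℕ) :
    |poissonPMF lam (m + 1) - poissonPMF lam m| ≤ 5 / 2 / (1 + lam) := by
  have h1lam : 0 < 1 + lam := by linarith
  -- the trivial bound by 1
  have htriv : |poissonPMF lam (m + 1) - poissonPMF lam m| ≤ 1 := by
    rw [abs_le]
    constructor
    · linarith [poissonPMF_nonneg hlam (m + 1), poissonPMF_le_one hlam m]
    · linarith [poissonPMF_nonneg hlam m, poissonPMF_le_one hlam (m + 1)]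
  rcases le_or_gt lam (3 / 2) with hsmall | hlarge
  · refine htriv.trans ?_
    rw [le_div_iff₀ h1lam]; linarith
  · have hlam0 : 0 < lam := by linarith
    -- Poi(m+1) − Poi(m) = Poi(m+1)·(λ − (m+1))/λ
    have hid : poissonPMF lam (m + 1) - poissonPMF lam m =
        -(((((m + 1 : ℕ) : ℝ) - lam) * poissonPMF lam (m + 1)) / lam) := by
      have h := succ_mul_poissonPMF_succ lam m
      push_cast
      field_simp
      linarith
    rw [hid, abs_neg, abs_div, abs_of_pos hlam0, abs_mul, abs_of_nonneg (poissonPMF_nonneg hlam _)]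
    have hb := abs_sub_mul_poissonPMF_le hlam0 (k := m + 1) (Nat.succ_ne_zero m)
    rw [div_le_iff₀ hlam0]
    calc |(((m + 1 : ℕ) : ℝ)) - lam| * poissonPMF lam (m + 1) ≤ 6 / 5 := hb
      _ ≤ 5 / 2 / (1 + lam) * lam := by
          rw [div_mul_eq_mul_div, le_div_iff₀ h1lam]; linarith

/-! ## 3. The tilted bound for the discrete derivative F(s,n) − F(s,n+1) of the Bessel kernel -/

variable {s a : ℝ}

/-- kernel: 1 − e^{−a} ≤ a. [folklore] -/
private theorem one_sub_exp_neg_le (a : ℝ) : 1 - Real.exp (-a) ≤ a := by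
  linarith [Real.add_one_le_exp (-a)]

/-- kernel (the tilted difference, termwise): with λ₁ = se^{−a}, λ₂ = se^{a},
(s^j/j!·s^{j+n}/(j+n)! − s^j/j!·s^{j+n+1}/(j+n+1)!)·e^{an} = e^{λ₁+λ₂}·Poi_{λ₁}(j)·(Poi_{λ₂}(j+n) − e^{−a}Poi_{λ₂}(j+n+1)).
[cite: Balaban1983Higgs3, (3.16) p.437] -/
theorem besselTerm_sub_mul_exp (s a : ℝ) (n j : ℕ) :
    (besselTerm s n j - besselTerm s (n + 1) j) * Real.exp (a * n) =
      Real.exp (s * Real.exp (-a) + s * Real.exp a) * poissonPMF (s * Real.exp (-a)) j *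
        (poissonPMF (s * Real.exp a) (j + n) - Real.exp (-a) * poissonPMF (s * Real.exp a) (j + n + 1)) := by
  have h1 := besselTerm_mul_exp s a n j
  have h2 := besselTerm_mul_exp s a (n + 1) j
  have h3 : besselTerm s (n + 1) j * Real.exp (a * n) =
      Real.exp (-a) * (besselTerm s (n + 1) j * Real.exp (a * ((n + 1 : ℕ) : ℝ))) := by
    rw [mul_comm (Real.exp (-a)), mul_assoc, ← Real.exp_add]
    congr 2; push_cast; ring
  rw [sub_mul, h1, h3, h2, ← add_assoc]
  ring

/-- kernel (termwise absolute bound): for s ≥ 0, a ≥ 0,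
|(besselTerm s n j − besselTerm s (n+1) j)·e^{an}| ≤ e^{2s cosh a}·((5/2)/(1+s) + 2a/√(1+s))·Poi_{se^{−a}}(j)
(`abs_poissonPMF_succ_sub_le` at the rate λ₂ = se^a ≥ s, `poissonPMF_le`, 1 − e^{−a} ≤ a). [cite: Balaban1983Higgs3, (3.16) p.437] -/
theorem abs_besselTerm_sub_mul_exp_le (hs : 0 ≤ s) (ha : 0 ≤ a) (n j : ℕ) :
    |(besselTerm s n j - besselTerm s (n + 1) j) * Real.exp (a * n)| ≤
      Real.exp (2 * s * Real.cosh a) * (5 / 2 / (1 + s) + 2 * a / Real.sqrt (1 + s)) *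
        poissonPMF (s * Real.exp (-a)) j := by
  set lam1 : ℝ := s * Real.exp (-a) with hlam1
  set lam2 : ℝ := s * Real.exp a with hlam2
  have hl1 : 0 ≤ lam1 := by positivity
  have hl2 : 0 ≤ lam2 := by positivity
  have hs2 : s ≤ lam2 := by
    rw [hlam2]; exact le_mul_of_one_le_right hs (Real.one_le_exp ha)
  have hcosh : lam1 + lam2 = 2 * s * Real.cosh a := by rw [hlam1, hlam2, Real.cosh_eq]; ring
  have h1s : 0 < 1 + s := by linarith
  have hsq : 0 < Real.sqrt (1 + s) := Real.sqrt_pos.2 h1s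
  rw [besselTerm_sub_mul_exp, ← hlam1, ← hlam2, hcosh]
  have hP1 : 0 ≤ poissonPMF lam1 j := poissonPMF_nonneg hl1 j
  -- the bracket: |Poi₂(j+n) − e^{−a}Poi₂(j+n+1)| ≤ (5/2)/(1+s) + 2a/√(1+s)
  have hbr : |poissonPMF lam2 (j + n) - Real.exp (-a) * poissonPMF lam2 (j + n + 1)| ≤
      5 / 2 / (1 + s) + 2 * a / Real.sqrt (1 + s) := by
    have e : poissonPMF lam2 (j + n) - Real.exp (-a) * poissonPMF lam2 (j + n + 1) =
        -(poissonPMF lam2 (j + n + 1) - poissonPMF lam2 (j + n)) + (1 - Real.exp (-a)) * poissonPMF lam2 (j + n + 1) := by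
      ring
    rw [e]
    refine (abs_add_le _ _).trans (add_le_add ?_ ?_)
    · rw [abs_neg]
      refine (abs_poissonPMF_succ_sub_le hl2 (j + n)).trans ?_
      exact div_le_div_of_nonneg_left (by norm_num) h1s (by linarith)
    · have h1a : 0 ≤ 1 - Real.exp (-a) := sub_nonneg.mpr (Real.exp_le_one_iff.mpr (neg_nonpos.mpr ha))
      rw [abs_mul, abs_of_nonneg h1a, abs_of_nonneg (poissonPMF_nonneg hl2 _)]
      have hP2 : poissonPMF lam2 (j + n + 1) ≤ 2 / Real.sqrt (1 + s) := by
        refine (poissonPMF_le hl2 _).trans ?_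
        exact div_le_div_of_nonneg_left (by norm_num) hsq (Real.sqrt_le_sqrt (by linarith))
      calc (1 - Real.exp (-a)) * poissonPMF lam2 (j + n + 1) ≤ a * (2 / Real.sqrt (1 + s)) :=
            mul_le_mul (one_sub_exp_neg_le a) hP2 (poissonPMF_nonneg hl2 _) ha
        _ = 2 * a / Real.sqrt (1 + s) := by ring
  rw [abs_mul, abs_mul, abs_of_pos (Real.exp_pos _), abs_of_nonneg hP1]
  calc Real.exp (2 * s * Real.cosh a) * poissonPMF lam1 j *
        |poissonPMF lam2 (j + n) - Real.exp (-a) * poissonPMF lam2 (j + n + 1)|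
      ≤ Real.exp (2 * s * Real.cosh a) * poissonPMF lam1 j * (5 / 2 / (1 + s) + 2 * a / Real.sqrt (1 + s)) :=
        mul_le_mul_of_nonneg_left hbr (by positivity)
    _ = _ := by ring

/-- kernel: |F(s,n) − F(s,n+1)|·e^{an} ≤ e^{2s cosh a}·((5/2)/(1+s) + 2a/√(1+s)) for s ≥ 0, a ≥ 0 (sum the termwise bound
against Σ_j Poi_{se^{−a}}(j) = 1). [cite: Balaban1983Higgs3, (3.16) p.437] -/
theorem abs_besselF_sub_succ_mul_exp_le (hs : 0 ≤ s) (ha : 0 ≤ a) (n : ℕ) :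
    |besselF s n - besselF s (n + 1)| * Real.exp (a * n) ≤
      Real.exp (2 * s * Real.cosh a) * (5 / 2 / (1 + s) + 2 * a / Real.sqrt (1 + s)) := by
  set lam1 : ℝ := s * Real.exp (-a) with hlam1
  set M : ℝ := Real.exp (2 * s * Real.cosh a) * (5 / 2 / (1 + s) + 2 * a / Real.sqrt (1 + s)) with hM
  have hl1 : 0 ≤ lam1 := by positivity
  have hL : HasSum (fun j => (besselTerm s n j - besselTerm s (n + 1) j) * Real.exp (a * n))
      ((besselF s n - besselF s (n + 1)) * Real.exp (a * n)) :=
    ((hasSum_besselF hs n).sub (hasSum_besselF hs (n + 1))).mul_right _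
  have hR : HasSum (fun j => M * poissonPMF lam1 j) M := by
    have h := (hasSum_poissonPMF hl1).mul_left M
    rwa [mul_one] at h
  have hpt : ∀ j, |(besselTerm s n j - besselTerm s (n + 1) j) * Real.exp (a * n)| ≤ M * poissonPMF lam1 j :=
    fun j => abs_besselTerm_sub_mul_exp_le hs ha n j
  have hup : (besselF s n - besselF s (n + 1)) * Real.exp (a * n) ≤ M :=
    hasSum_le (fun j => (le_abs_self _).trans (hpt j)) hL hR
  have hlo : -((besselF s n - besselF s (n + 1)) * Real.exp (a * n)) ≤ M :=
    hasSum_le (fun j => (neg_le_abs _).trans (hpt j)) hL.neg hR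
  have h : |(besselF s n - besselF s (n + 1)) * Real.exp (a * n)| ≤ M := abs_le.mpr ⟨by linarith, hup⟩
  rwa [abs_mul, abs_of_pos (Real.exp_pos _)] at h

/-- **The tilted bound for the discrete derivative of the one-dimensional kernel**:
|F(s,n) − F(s,n+1)| ≤ e^{2s cosh a − a·n}·((5/2)/(1+s) + 2a/√(1+s)) for all s ≥ 0, a ≥ 0, n ∈ ℕ — compare
`B3CxiBesselKernel.besselF_le` (F(s,n) ≤ 2(1+s)^{−1/2}e^{2s cosh a − an}): differencing in n gains (1+s)^{−1/2}, up to the tilt a.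
[cite: Balaban1983Higgs3, (3.16) p.437] -/
theorem abs_besselF_sub_succ_le (hs : 0 ≤ s) (ha : 0 ≤ a) (n : ℕ) :
    |besselF s n - besselF s (n + 1)| ≤
      Real.exp (2 * s * Real.cosh a - a * n) * (5 / 2 / (1 + s) + 2 * a / Real.sqrt (1 + s)) := by
  have h := abs_besselF_sub_succ_mul_exp_le hs ha n
  rw [Real.exp_sub, div_mul_eq_mul_div, le_div_iff₀ (Real.exp_pos _)]
  exact h

/-- kernel: the same bound in the shape (2/√(1+s))·e^{2s cosh a − an}·(5/(4√(1+s)) + a) — `besselF_le`'s right-hand side times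
the extra factor 5/(4√(1+s)) + a. [cite: Balaban1983Higgs3, (3.16) p.437] -/
theorem abs_besselF_sub_succ_le' (hs : 0 ≤ s) (ha : 0 ≤ a) (n : ℕ) :
    |besselF s n - besselF s (n + 1)| ≤
      2 / Real.sqrt (1 + s) * Real.exp (2 * s * Real.cosh a - a * n) * (5 / (4 * Real.sqrt (1 + s)) + a) := by
  refine (abs_besselF_sub_succ_le hs ha n).trans_eq ?_
  have hsq : 0 < Real.sqrt (1 + s) := Real.sqrt_pos.2 (by linarith)
  have h1s : Real.sqrt (1 + s) ^ 2 = 1 + s := Real.sq_sqrt (by linarith)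
  set y := Real.sqrt (1 + s) with hy
  rw [← h1s]
  field_simp
  ring

/-- kernel: the untilted case a = 0: |F(s,n) − F(s,n+1)| ≤ (5/2)e^{2s}/(1+s). [cite: Balaban1983Higgs3, (3.16) p.437] -/
theorem abs_besselF_sub_succ_le_diag (hs : 0 ≤ s) (n : ℕ) :
    |besselF s n - besselF s (n + 1)| ≤ Real.exp (2 * s) * (5 / 2 / (1 + s)) := by
  have h := abs_besselF_sub_succ_le hs le_rfl n
  rwa [Real.cosh_zero, mul_one, zero_mul, sub_zero, mul_zero, zero_div, add_zero] at h

end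

end Literature.MathematicalPhysics.QuantumFieldTheory.Balaban1983to89.B3CxiBesselDifference
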